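import Summits.BirchSwinnertonDyer.BirchSwinnertonDyer.Theorems.EisensteinPrimesSplitMultCharImprimitiveShift
import HarnessLib

/-!
# Crux 4 `BSDpOnCellC` (stmt-BirchSwinnertonDyer-19034), line b1 — the SPLIT conjunct of the wall `stub_imprimitiveCount`:
# THE ALGEBRAIC SIDE ASSEMBLED IN THE PRIMITIVE CHARACTER CURRENCY —
# `λ(𝔛_nr(θsub)) + λ(𝔛_nr(θquot)) + Σ_{w∈Sf}(λ𝒫_w(θsub) + λ𝒫_w(θquot)) ≤ λ(𝔛^{Sf}_f) + [θquot = 𝟙]` at a SPLIT multiplicative Eisenstein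
# prime, `Sf` = places over `N` off `p` (line b1's binder), kernel modulo Greenberg ×5 + `cd_p(G_{K,Σ}) ≤ 2` BY NAME

Cell `bsd-eis` (run/shared/lean/pub/bsd-eis/), width seat `bsd-line-x2-p2` gen 10 (`--supports -19034`, closes nothing; skeleton of
record b1 v12 sha256 155e218d… UNCHANGED, W-79). Assembles this seat's `SplitMultSfTransfer.lambdaInvariant_add_le_of_split_offP` (p675360: KY
Thm. 1.4.1 (iii) at the split datum for the IMPRIMITIVE duals) with `SplitMultCharImprimitiveShift.imprimitive_clauses_of_split` (KY/CGLS Prop. 1.2.5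
at the split datum: `λ(𝔛^{Sf}_θ) = λ(𝔛_θ) + Σ λ𝒫_w(θ)`), so that the split conjunct's algebraic side has EXACTLY the shape of the non-split
chain's (this lineage g8/g9, `…ImprimitiveCountNonsplitOfAnBr`): what remains between it and conj. 2 of the wall VERBATIM is [BR𝟙] at the
`p`-unramified member `θquot` (`X1.KellerYinMuLambdaSplit.CharMainConjOnTree`: `λ(𝔛_nr(θquot)) = n + [θquot = 𝟙]`), the functional-equation
reading at `θsub` (`λ(𝔛_nr(θsub)) = n`), ONE analytic sentence at `p ‖ N` (`m + Σ λ𝒫_w(f) ≤ 2n + ΣΣ`), and the isogeny normalisation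
(«E(K)[p] = 0», orientation) — the LEAD's composition.

HONEST FRAMING: helper theorem only (0 defs, 0 named facts introduced, 0 sorry); CONDITIONAL on the six named published facts it takes as
hypotheses (Greenberg 2016 Prop. 2.6.3; Greenberg 2006 Props. 4.1, 4.2, §5 A, 3.2; NSW (8.3.18)); closes no stub; no summit statement / BSD / MC /
IMC / KY Thm. 1.4.1 (iii) for any curve is proved here; 0 cells / labels / tiers move.

References: [KellerYin2024] Thm. 1.4.1 (iii), Prop. 1.2.5, §5.1 (arXiv:2402.12781v2); [CastellaGrossiLeeSkinner2022] Prop. 1.2.5, proof of Thm. 1.5.1;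
[GreenbergVatsal2000] §2; [Greenberg2016Selmer] Prop. 2.6.3; [Greenberg2006] Props. 3.2, 4.1, 4.2, §5 A; [NeukirchSchmidtWingberg2008] (8.3.18).
-/

set_option autoImplicit false
set_option linter.dupNamespace false

noncomputable section

open scoped Classical
open NumberField IsDedekindDomain Field Multiplicative PowerSeries WeierstrassCurve
open Literature.NumberTheory.EllipticCurves Literature.NumberTheory.EllipticCurves.GreenbergSelmer
  Literature.NumberTheory.EllipticCurves.GreenbergVatsal2000 Literature.NumberTheory.GaloisRepresentations
  Literature.NumberTheory.EllipticCurves.KellerYin2024 Literature.NumberTheory.EllipticCurves.IwasawaDual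
  Literature.NumberTheory.IwasawaTheory Literature.NumberTheory.IwasawaTheory.Greenberg2016
  Literature.NumberTheory.IwasawaTheory.Greenberg2006 Literature.NumberTheory.EllipticCurves.Castella2018
  Literature.NumberTheory.GaloisCohomology
  Summit.BirchSwinnertonDyer.BirchSwinnertonDyer.Theorems

namespace Summit.BirchSwinnertonDyer.BirchSwinnertonDyer.Theorems.SplitMultAlgebraicSide

variable {K : Type} [Field K] [NumberField K] {p : ℕ} [hp : Fact p.Prime]

/-- **THE ALGEBRAIC SIDE OF THE SPLIT CONJUNCT, PRIMITIVE CURRENCY.** `W/ℚ` globally minimal, `2 < p` SPLIT multiplicative, `K` imaginary quadratic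
with (Heeg) for `N_W` and `(p)` split, `E(K)[p] = 0`, `v` through `ι`, `v̄ ∋ p`, `v̄ ≠ v`, `κ` anticyclotomic with topological generator `γ`, a residual
pair `(θsub, θquot)` with `θsub` RAMIFIED at `v̄` (orientation (ω, 𝟙); supplied by `SplitMultOrientation` from «`θquot` unramified at `v̄`»), `Sf`
line b1's set (`w ∈ Sf ↔ (N_W ∈ w ∧ p ∉ w)`), PRIMITIVE dual data `Dsub`, `Dquot` (`S = ∅`), [RH] for both characters (every primitive dual datum
f.g. `Λ`-torsion `μ = 0` — the FIRST clauses of the [BR] inputs), and `𝔛^{Sf}_f` f.g. `Λ`-torsion with `μ = 0` (Keller–Yin Lemma 5.1.1 =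
`stub_lemma511`); GRANTED the six named PUB facts:
`λ(Dsub.X) + λ(Dquot.X) + Σ_{w∈Sf}(λ𝒫_w(θsub) + λ𝒫_w(θquot)) ≤ λ(𝔛^{Sf}_f) + [θquot = 𝟙]`.
[cite: KellerYin2024, Thm. 1.4.1 (iii), Prop. 1.2.5, Lemma 5.1.1, §5.1 (arXiv:2402.12781v2)] [cite: CastellaGrossiLeeSkinner2022, Prop. 1.2.5, proof of Thm. 1.5.1 (eq:lambda-imp)]
[cite: Greenberg2016Selmer, Prop. 2.6.3] [cite: Greenberg2006, Props. 3.2, 4.1, 4.2, §5 A] [cite: NeukirchSchmidtWingberg2008, (8.3.18)] -/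
theorem lambdaInvariant_primitive_add_sum_le_of_split (h263 : prop263_sur_of_crk) (h41 : prop41_globalEulerPoincareCorank)
    (h42 : prop42_localEulerPoincareCorank) (h5A : sec5A_localH2_subsingleton_of_LOC1)
    (h32 : prop32_cohomology_isCofinitelyGenerated)
    (W : WeierstrassCurve ℚ) [W.IsElliptic] [W.IsGloballyMinimal]
    (hp : 2 < p) (hsplitred : W.HasSplitMultiplicativeReductionAtPrime p)
    (hK : IsImaginaryQuadratic K) (hCD2 : groupCdLE_two_galoisGroupUnramifiedOutside K)
    (hH : SatisfiesHeegnerHypothesis (W.conductorNorm ℤ) K)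
    (hsplit : ((Ideal.span {(p : ℤ)}).primesOver (𝓞 K)).ncard = 2)
    (htor : ∀ Q : (W.baseChange K).toAffine.Point, p • Q = 0 → Q = 0)
    (ι : K →+* ℚ_[p]) (v vbar : HeightOneSpectrum (𝓞 K))
    (hv : ∀ x : 𝓞 K, x ∈ v.asIdeal ↔ ‖ι (x : K)‖ < 1)
    (hvbar : ((p : ℕ) : 𝓞 K) ∈ vbar.asIdeal) (hne : vbar ≠ v)
    (κ : ZpExtension K p) (hκ : κ.IsAnticyclotomic)
    (γ : absoluteGaloisGroup K) [Fact (κ.IsTopGenerator γ)]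
    (θsub θquot : FramedGaloisRep K (padicCoeffIntegers (∅ : Set (PadicAlgCl p))) 1)
    (hpair : IsResidualPairOver (W.baseChange K) p θsub θquot)
    (hramI : ∃ τ ∈ inertia vbar, unitChar θsub τ ≠ 1)
    (Sf : Finset (HeightOneSpectrum (𝓞 K)))
    (hSf : ∀ w : HeightOneSpectrum (𝓞 K), w ∈ Sf ↔
      (((W.conductorNorm ℤ : ℤ) : 𝓞 K) ∈ w.asIdeal ∧ ((p : ℕ) : 𝓞 K) ∉ w.asIdeal))
    (Dsub : DatumDualData κ γ (charModule ∅ θsub)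
        (AcSelmer.bdpData (charModule ∅ θsub) p vbar) (∅ : Set (HeightOneSpectrum (𝓞 K))))
    (Dquot : DatumDualData κ γ (charModule ∅ θquot)
        (AcSelmer.bdpData (charModule ∅ θquot) p vbar) (∅ : Set (HeightOneSpectrum (𝓞 K))))
    (hfgS : Module.Finite (IwasawaAlgebra p) (AcSelmer.XAc (W.baseChange K) p κ vbar (↑Sf : Set (HeightOneSpectrum (𝓞 K))) γ))
    (htorS : Module.IsTorsion (IwasawaAlgebra p) (AcSelmer.XAc (W.baseChange K) p κ vbar (↑Sf : Set (HeightOneSpectrum (𝓞 K))) γ))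
    (hμS : muInvariant p (AcSelmer.XAc (W.baseChange K) p κ vbar (↑Sf : Set (HeightOneSpectrum (𝓞 K))) γ) = 0)
    (hRHsub : ∀ D : DatumDualData κ γ (charModule ∅ θsub)
        (AcSelmer.bdpData (charModule ∅ θsub) p vbar) (∅ : Set (HeightOneSpectrum (𝓞 K))),
      Module.Finite (IwasawaAlgebra p) D.X ∧ Module.IsTorsion (IwasawaAlgebra p) D.X ∧ muInvariant p D.X = 0)
    (hRHquot : ∀ D : DatumDualData κ γ (charModule ∅ θquot)
        (AcSelmer.bdpData (charModule ∅ θquot) p vbar) (∅ : Set (HeightOneSpectrum (𝓞 K))),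
      Module.Finite (IwasawaAlgebra p) D.X ∧ Module.IsTorsion (IwasawaAlgebra p) D.X ∧ muInvariant p D.X = 0) :
    lambdaInvariant p Dsub.X + lambdaInvariant p Dquot.X +
        ∑ w ∈ Sf, (charLocalLambda ∅ κ θsub w + charLocalLambda ∅ κ θquot w) ≤
      lambdaInvariant p (AcSelmer.XAc (W.baseChange K) p κ vbar (↑Sf : Set (HeightOneSpectrum (𝓞 K))) γ) +
        (if ∀ σ : absoluteGaloisGroup K, θquot σ = 1 then 1 else 0) := by
  have hγ : κ.IsTopGenerator γ := Fact.out
  -- imprimitive dual data over `Sf` exist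
  obtain ⟨DSsub⟩ := nonempty_unrDualData_char (∅ : Set (PadicAlgCl p)) θsub κ vbar (↑Sf : Set (HeightOneSpectrum (𝓞 K))) hγ
  obtain ⟨DSquot⟩ := nonempty_unrDualData_char (∅ : Set (PadicAlgCl p)) θquot κ vbar (↑Sf : Set (HeightOneSpectrum (𝓞 K))) hγ
  -- Prop. 1.2.5 at the split datum for both characters: cotorsion of every imprimitive datum and the `λ`-shifts
  have hsubP := fun DS ↦ SplitMultCharImprimitiveShift.imprimitive_clauses_of_split h263 h41 h42 h5A h32 W hp hsplitred hK hH hv hvbar hne κ hκ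
    γ hpair Sf hSf θsub (Or.inl rfl) hRHsub Dsub DS
  have hquotP := fun DS ↦ SplitMultCharImprimitiveShift.imprimitive_clauses_of_split h263 h41 h42 h5A h32 W hp hsplitred hK hH hv hvbar hne κ
    hκ γ hpair Sf hSf θquot (Or.inr rfl) hRHquot Dquot DS
  have hSsub : ∀ DS : DatumDualData κ γ (charModule ∅ θsub)
      (AcSelmer.bdpData (charModule ∅ θsub) p vbar) (↑Sf : Set (HeightOneSpectrum (𝓞 K))),
      Module.Finite (IwasawaAlgebra p) DS.X ∧ Module.IsTorsion (IwasawaAlgebra p) DS.X ∧ muInvariant p DS.X = 0 := fun DS ↦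
    ⟨(hsubP DS).1, (hsubP DS).2.1, (hsubP DS).2.2.1⟩
  have hSquot : ∀ DS : DatumDualData κ γ (charModule ∅ θquot)
      (AcSelmer.bdpData (charModule ∅ θquot) p vbar) (↑Sf : Set (HeightOneSpectrum (𝓞 K))),
      Module.Finite (IwasawaAlgebra p) DS.X ∧ Module.IsTorsion (IwasawaAlgebra p) DS.X ∧ muInvariant p DS.X = 0 := fun DS ↦
    ⟨(hquotP DS).1, (hquotP DS).2.1, (hquotP DS).2.2.1⟩
  have hlsub : lambdaInvariant p DSsub.X = lambdaInvariant p Dsub.X + ∑ w ∈ Sf, charLocalLambda ∅ κ θsub w := (hsubP DSsub).2.2.2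
  have hlquot : lambdaInvariant p DSquot.X = lambdaInvariant p Dquot.X + ∑ w ∈ Sf, charLocalLambda ∅ κ θquot w := (hquotP DSquot).2.2.2
  -- KY Thm. 1.4.1 (iii) at the split datum for the imprimitive duals
  have hmain := SplitMultSfTransfer.lambdaInvariant_add_le_of_split_offP h263 h41 h42 h5A h32 W p hp hsplitred K hK hCD2 hH hsplit htor ι v vbar
    hv hvbar hne κ hκ γ θsub θquot hpair hramI Sf hSf DSsub DSquot hfgS htorS hμS hSsub hSquot
  rw [hlsub, hlquot] at hmain
  rw [Finset.sum_add_distrib]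
  omega

end Summit.BirchSwinnertonDyer.BirchSwinnertonDyer.Theorems.SplitMultAlgebraicSide

end
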